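import Summits.BirchSwinnertonDyer.BirchSwinnertonDyer.Theorems.ResidualThetaTransportAtTwoSignedMuSeedAtTwoPlusSmoothingCoboundary
import Summits.BirchSwinnertonDyer.BirchSwinnertonDyer.Theorems.ResidualThetaTransportAtTwoSignedMuSeedAtTwoPlusSmoothingCoboundaryMahler
import HarnessLib

/-!
# Smoothing coboundary V — bridge: in the power-series model the unit hypothesis of the operator coboundary law is a
# THEOREM (the twisted substitution endomorphism `η·(∘s) − 1` of `k⟦T⟧` is a unit), so the class series exists and is unique;
# plus the twist bookkeeping of J5(a) («never exactly two of the three twists silent»)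
# (seed crux `SignedMuSeedAtTwoPlus` stmt-BirchSwinnertonDyer-21438; parent Kμ⁺ stmt-BirchSwinnertonDyer-20689, route
# ResidualThetaTransportAtTwo; line card `Cruxes/SignedMuSeedAtTwoPlus/Lines/smoothing-coboundary.md`, CS2/CS5 and J5(a))

Cell `bsd-wall`, width seat `bsd-wall-rtt-p4-w2` g15 (`--supports`, closes nothing).  THEOREMS ONLY; BSD is not proved by this.

* **`isUnit_twistSubstEnd`** — for `η − 1` a unit of `k` and `s ≡ T (mod T²)`, the `k`-linear endomorphism
  `η • (substAlgHom s) − 1` of `k⟦T⟧` is a unit of `Module.End k k⟦T⟧` (`…Mahler.mahler_existsUnique` + `Module.End.isUnit_iff`):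
  the hypothesis `∃ b₀, IsUnit (η b₀ • ρ b₀ − 1)` of `…SmoothingCoboundary.operatorCoboundaryLaw` is DISCHARGED whenever one
  `ρ b₀` is substitution by such an `s` (card: `β ≡ 1 (mod 2𝒪_K)`, `χ₀(β) ≠ 1`);
* **`operatorCoboundaryLaw_subst`**, `classSeries_unique_subst` — the operator coboundary law and the uniqueness of the class
  vector in that model: `∃ G, ∀ a, F a = (η a • ρ a − 1) G`, and `G` is unique;
* `silent_conj_iff` — `η' * η = 1 ⇒ (η' = 1 ↔ η = 1)` (conjugate primes are silent together);
* **`twistZeros_not_two`** — for `c³ = 1` the three conditions `w = 1`, `w·c = 1`, `w·c² = 1` (silence of the twists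
  `e = 0, 1, 2`, multipliers `η_e = ω̃·χ₀^e`) are never satisfied by exactly two of them (J5(a) of `Lines/jet-character-sums.md`
  as read by the card: zeros among the three live twists at a norm number `0`, `1` or `3`).

[folklore]
-/

noncomputable section

set_option autoImplicit false
-- the Theorems namespace of this sub repeats the summit name by design (D-0017 nested layout)
set_option linter.dupNamespace false

open PowerSeries

namespace Summit.BirchSwinnertonDyer.BirchSwinnertonDyer.Theorems.SignedMuAtTwo.SmoothingCoboundary

section PowerSeriesModel

variable {k : Type*} [CommRing k]

/-- The twisted substitution endomorphism applied: `(η • subst_s − 1) G = η • G∘s − G`. [folklore] -/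
theorem twistSubstEnd_apply (η : k) {s : PowerSeries k} (hs0 : constantCoeff s = 0) (G : PowerSeries k) :
    (η • (substAlgHom (HasSubst.of_constantCoeff_zero' hs0)).toLinearMap - 1 : Module.End k (PowerSeries k)) G
      = η • G.subst s - G := by
  rw [LinearMap.sub_apply, LinearMap.smul_apply, AlgHom.toLinearMap_apply, coe_substAlgHom, Module.End.one_apply]

/-- **The twisted substitution endomorphism is a unit**: for `η − 1` a unit of `k` and `s ≡ T (mod T²)`
(`constantCoeff s = 0`, `coeff 1 s = 1`), `η • subst_s − 1 ∈ (Module.End k k⟦T⟧)ˣ` — the card's «`U_β` is invertible on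
`𝔽̄₂⟦T⟧`», discharging the unit hypothesis of `operatorCoboundaryLaw` in the power-series model. [folklore] -/
theorem isUnit_twistSubstEnd {η : k} (hη : IsUnit (η - 1)) {s : PowerSeries k} (hs0 : constantCoeff s = 0)
    (hs1 : coeff 1 s = 1) :
    IsUnit (η • (substAlgHom (HasSubst.of_constantCoeff_zero' hs0)).toLinearMap - 1 : Module.End k (PowerSeries k)) := by
  rw [Module.End.isUnit_iff, Function.bijective_iff_existsUnique]
  intro Φ
  simp_rw [twistSubstEnd_apply η hs0]
  exact mahler_existsUnique hη hs0 hs1 Φ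

variable {M : Type*} [CommMonoid M] (η : M →* k) (ρ : M →* Module.End k (PowerSeries k)) (F : M → PowerSeries k)

/-- **Operator coboundary law in the power-series model**: an operator twisted cocycle `F (a*b) = F b + η b • ρ b (F a)` with
values in `k⟦T⟧`, one of whose operators `ρ b₀` is substitution by some `s ≡ T (mod T²)` with `η b₀ − 1` a unit, is a
coboundary: `∃ G, ∀ a, F a = (η a • ρ a − 1) G` (card (B): `F°_α = G_χ + η(α)·G_χ∘[α]`, one class series `G_χ`). [folklore] -/
theorem operatorCoboundaryLaw_subst (hF : ∀ a b, F (a * b) = F b + η b • ρ b (F a)) {b₀ : M} (hη : IsUnit (η b₀ - 1))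
    {s : PowerSeries k} (hs0 : constantCoeff s = 0) (hs1 : coeff 1 s = 1)
    (hρ : ρ b₀ = (substAlgHom (HasSubst.of_constantCoeff_zero' hs0)).toLinearMap) :
    ∃ G : PowerSeries k, ∀ a, F a = (η a • ρ a - 1 : Module.End k (PowerSeries k)) G :=
  operatorCoboundaryLaw η ρ F hF ⟨b₀, by rw [hρ]; exact isUnit_twistSubstEnd hη hs0 hs1⟩

/-- **Uniqueness of the class series in the power-series model**: with `b₀` as above, `(η b₀ • ρ b₀ − 1) G = (η b₀ • ρ b₀ − 1) G'`
forces `G = G'` (card: `G_χ` is CANONICAL). [folklore] -/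
theorem classSeries_unique_subst {b₀ : M} (hη : IsUnit (η b₀ - 1)) {s : PowerSeries k} (hs0 : constantCoeff s = 0)
    (hs1 : coeff 1 s = 1) (hρ : ρ b₀ = (substAlgHom (HasSubst.of_constantCoeff_zero' hs0)).toLinearMap)
    {G G' : PowerSeries k}
    (h : (η b₀ • ρ b₀ - 1 : Module.End k (PowerSeries k)) G = (η b₀ • ρ b₀ - 1 : Module.End k (PowerSeries k)) G') :
    G = G' :=
  operatorCoboundaryLaw_unique η ρ (b₀ := b₀) (by rw [hρ]; exact isUnit_twistSubstEnd hη hs0 hs1) h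

end PowerSeriesModel

/-! ## Twist bookkeeping -/

section Twists

variable {N : Type*} [CommMonoid N]

/-- Conjugate elements are silent together: `η' * η = 1 ⇒ (η' = 1 ↔ η = 1)` (card: `η(π̄) = η(π)⁻¹`, so conjugate primes agree).
[folklore] -/
theorem silent_conj_iff {η η' : N} (h : η' * η = 1) : η' = 1 ↔ η = 1 := by
  constructor
  · intro h'; rwa [h', one_mul] at h
  · intro h'; rwa [h', mul_one] at h

/-- **Never exactly two of the three twists are silent** (J5(a)): for `c³ = 1`, among the conditions `w = 1`, `w·c = 1`,
`w·c² = 1` (silence `η_e = 1` of the twists `e = 0, 1, 2`, `η_e = ω̃·χ₀^e` with `w = ω̃(π)`, `c = χ₀(π)`), any two imply the third.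
[folklore] -/
theorem twistZeros_not_two {w c : N} (hc : c ^ 3 = 1) :
    (w = 1 → w * c = 1 → w * c ^ 2 = 1) ∧ (w = 1 → w * c ^ 2 = 1 → w * c = 1) ∧
      (w * c = 1 → w * c ^ 2 = 1 → w = 1) := by
  refine ⟨fun h0 h1 => ?_, fun h0 h2 => ?_, fun h1 h2 => ?_⟩
  · rw [h0, one_mul] at h1
    rw [h0, h1, one_pow, mul_one]
  · subst h0
    rw [one_mul] at h2 ⊢
    calc c = c * c ^ 2 := by rw [h2, mul_one]
      _ = c ^ 3 := by rw [pow_two, ← pow_three]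
      _ = 1 := hc
  · have hc1 : c = 1 := by
      calc c = w * c * c := by rw [h1, one_mul]
        _ = w * c ^ 2 := by rw [pow_two, mul_assoc]
        _ = 1 := h2
    rwa [hc1, mul_one] at h1

/-- Corollary: if the twist `e = 1` is silent and `e = 2` is not (or vice versa), then `e = 0` is not silent either —
the pattern «exactly the two non-trivial twists» / «exactly one non-trivial and the trivial twist» cannot occur. [folklore] -/
theorem twistZero_of_one_not_two {w c : N} (hc : c ^ 3 = 1) (h1 : w * c = 1) (h2 : w * c ^ 2 ≠ 1) : w ≠ 1 :=
  fun h0 => h2 ((twistZeros_not_two hc).1 h0 h1)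

end Twists

end Summit.BirchSwinnertonDyer.BirchSwinnertonDyer.Theorems.SignedMuAtTwo.SmoothingCoboundary
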